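import Mathlib.NumberTheory.Zsqrtd.Basic
import Mathlib.RingTheory.Ideal.Operations
import Mathlib.RingTheory.Ideal.Span
import Mathlib.Tactic.Ring
import Mathlib.Tactic.LinearCombination
import Mathlib.Tactic.Linarith
import HarnessLib

/-!
# Venture HSemireg — LEMMA 𝔭, the prime over 2 (ENGINE-W PROBE5 §13), at the level of `ℤ[√m]`: `𝔭 = (2, 1+√m)` (`m` odd) resp.
# `(2, √m)` (`m` even) has `𝔭² = (2)` for `m ≡ 2, 3 (mod 4)` and `𝔭² = 2𝔭` for `m ≡ 1 (mod 4)`; `𝔭 = (2, A+√m)` for every twist `A` of the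
# right parity; `τ(𝔭) = 𝔭`; and `𝔭` is principal, generated by `x + y√m`, whenever `x² − m·y² = ±2` — kernel ideal arithmetic in Mathlib's `ℤ√m`

HONEST FRAMING. Lean index of the computation cell `pub-hsemireg`, widening group ENGINE-W (code A, seat `engine-w-1`, gen 18).
IDEAL ARITHMETIC IN `ℤ√m` ONLY (the order `ℤ[√m]`, not `R = ℤ[ω, √m]` of the card — the statements below are the `ℤ[√m]`-shadows of LEMMA 𝔭);
no lattice `I₁, I₂`, abelian variety, sheaf, `Ext` group, autoequivalence or semiregularity map is constructed; nothing here says that HC, HC_CM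
or HC_AV holds. Theorems only (0 `def`, 0 named fact, 0 `sorry`). New namespace `PrimeOverTwo`. Companions: `R1DiophantinePellTwo.lean`
(§13's Diophantine side: which `m` have `x² − m y² = 2`), `LineLawPrincipalGenus.lean` ∕ `LineLawRamifiedCapture.lean` (code B's ideal toolkit
for `(n, −A + l)`).

SOURCE (the cell's own result, by value): `widen/ENGINE-W/out/probe5/PROBE5-STIZ-A.md` §13 «LEMMA 𝔭 (all targets). Let 𝔭 := (2, 1 + l)_R for
m odd, 𝔭 := (2, l)_R for m even. Then 𝔭 is the unique prime of R above 2 (R∕𝔭 = 𝔽₄, 𝔭² = 2R, τ(𝔭) = 𝔭 …)»; «(I₂:I₁) = … = ½·(2, A + l)_R =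
½𝔭 (A ≡ 1 resp. 0 mod 2)»; «So the RATIO LEMMAS of §10∕§12 are exactly the statement «𝔭 is principal, 𝔭 = (u + l)»»; THEOREM R1-DIOPHANTINE
(«𝔭 is principal, 𝔭 = α₀R … there is α₀ ∈ R with α₀·τ(α₀) = 2»); THEOREM R1-ℤ (§3: `m ≡ 1 (mod 4)` never). What the kernel holds (in `ℤ√m`,
`l = ⟨0,1⟩`):

* §1 **`𝔭² = (2)`**: `pTwo_sq_three_mod_four` (`m = 4k+3`: `(2, 1+l)² = (2)`, with the explicit relation
  `2 = (1+l)² − 2(1+l) − 4k`), `pTwo_sq_two_mod_four` (`m = 4k+2`: `(2, l)² = (2)`, `2 = 4(k+1) − l²`); and the NON-maximal contrast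
  `pTwo_sq_one_mod_four` (`m = 4k+1`: `(2, 1+l)² = (2)·(2, 1+l) = 2𝔭` — `𝔭` is not invertible in `ℤ[√m]`, the shadow of THEOREM R1-ℤ).
* §2 **`𝔭` absorbs the twist and is `τ`-stable**: `pTwo_twist_odd` (`A` odd ⟹ `(2, A + l) = (2, 1 + l)`), `pTwo_twist_even` (`A` even ⟹
  `(2, A + l) = (2, l)`), `pTwo_conj` (`(2, 1 − l) = (2, 1 + l)`, i.e. `τ(𝔭) = 𝔭`; for `m` even `τ(2, l) = (2, −l) = (2, l)`: `pTwo_conj_even`).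
* §3 **principal generators**: `pTwo_principal_odd` (`x, y` odd, `x² − m·y² = 2ε`, `ε = ±1` ⟹ `(2, 1+l) = (x + y·l)`), `pTwo_principal_even`
  (`m`, `x` even, `x² − m·y² = 2ε` ⟹ `(2, l) = (x + y·l)`); instances `inst_7` (`(2,1+√7) = (3+√7)`, norm `+2`), `inst_31`
  (`(2,1+√31) = (39+7√31)`, norm `+2`), `inst_3` (`(2,1+√3) = (1+√3)`, norm `−2`: principal, yet R1 PROPER is NOT reached for `ℚ(√3)` — the
  generator's norm sign is what THEOREM R1-DIOPHANTINE asks), `inst_neg1` (`(2,1+i) = (1+i)`), `inst_neg2` (`(2,√−2) = (√−2)`).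
-/

namespace Summit.Ventures.HSemireg.PrimeOverTwo

open Ideal

/-- Membership of a product of two elements of `(a, b)·(a, b)` in an ideal `K`, from the four products. -/
private theorem mul_mem_of_gens {R : Type*} [CommRing R] {a b : R} {K : Ideal R}
    (haa : a * a ∈ K) (hab : a * b ∈ K) (hbb : b * b ∈ K) :
    Ideal.span {a, b} * Ideal.span {a, b} ≤ K := by
  rw [Ideal.mul_le]
  intro x hx y hy
  obtain ⟨u, v, rfl⟩ := Ideal.mem_span_pair.1 hx
  obtain ⟨u', v', rfl⟩ := Ideal.mem_span_pair.1 hy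
  have e : (u * a + v * b) * (u' * a + v' * b) = (u * u') * (a * a) + (u * v' + v * u') * (a * b) + (v * v') * (b * b) := by ring
  rw [e]
  exact K.add_mem (K.add_mem (K.mul_mem_left _ haa) (K.mul_mem_left _ hab)) (K.mul_mem_left _ hbb)

/-! ## §1 `𝔭² = (2)` for `m ≡ 2, 3 (mod 4)`; `𝔭² = 2𝔭` for `m ≡ 1 (mod 4)` -/

/-- **`m = 4k + 3`: `(2, 1 + √m)² = (2)`** in `ℤ√m`. (`⊆`: `(1+l)² = (1+m) + 2l = 2·((2k+2) + l)`; `⊇`: `2 = (1+l)² − 2(1+l) − k·4`.) [kernel] -/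
theorem pTwo_sq_three_mod_four {m : ℤ} (k : ℤ) (hm : m = 4 * k + 3) :
    Ideal.span {(2 : ℤ√m), ⟨1, 1⟩} ^ 2 = Ideal.span {(2 : ℤ√m)} := by
  rw [pow_two]
  apply le_antisymm
  · apply mul_mem_of_gens
    · exact Ideal.mem_span_singleton.2 ⟨2, by ext <;> simp⟩
    · exact Ideal.mem_span_singleton.2 ⟨⟨1, 1⟩, rfl⟩
    · exact Ideal.mem_span_singleton.2 ⟨⟨2 * k + 2, 1⟩, by ext <;> simp [hm]; ring⟩
  · rw [Ideal.span_singleton_le_iff_mem]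
    have h1 : (⟨1, 1⟩ : ℤ√m) * ⟨1, 1⟩ ∈ Ideal.span {(2 : ℤ√m), ⟨1, 1⟩} * Ideal.span {(2 : ℤ√m), ⟨1, 1⟩} :=
      Ideal.mul_mem_mul (Ideal.subset_span (by simp)) (Ideal.subset_span (by simp))
    have h2 : (2 : ℤ√m) * ⟨1, 1⟩ ∈ Ideal.span {(2 : ℤ√m), ⟨1, 1⟩} * Ideal.span {(2 : ℤ√m), ⟨1, 1⟩} :=
      Ideal.mul_mem_mul (Ideal.subset_span (by simp)) (Ideal.subset_span (by simp))
    have h3 : (2 : ℤ√m) * 2 ∈ Ideal.span {(2 : ℤ√m), ⟨1, 1⟩} * Ideal.span {(2 : ℤ√m), ⟨1, 1⟩} :=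
      Ideal.mul_mem_mul (Ideal.subset_span (by simp)) (Ideal.subset_span (by simp))
    have e : (2 : ℤ√m) = (⟨1, 1⟩ : ℤ√m) * ⟨1, 1⟩ - (2 : ℤ√m) * ⟨1, 1⟩ - (k : ℤ√m) * ((2 : ℤ√m) * 2) := by
      ext <;> simp [hm]; ring
    have hmem := Ideal.sub_mem _ (Ideal.sub_mem _ h1 h2) (Ideal.mul_mem_left _ (k : ℤ√m) h3)
    rwa [← e] at hmem

/-- **`m = 4k + 2`: `(2, √m)² = (2)`** in `ℤ√m`. (`l² = m = 2(2k+1)`; `2 = 4(k+1) − l²`.) [kernel] -/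
theorem pTwo_sq_two_mod_four {m : ℤ} (k : ℤ) (hm : m = 4 * k + 2) :
    Ideal.span {(2 : ℤ√m), ⟨0, 1⟩} ^ 2 = Ideal.span {(2 : ℤ√m)} := by
  rw [pow_two]
  apply le_antisymm
  · apply mul_mem_of_gens
    · exact Ideal.mem_span_singleton.2 ⟨2, by ext <;> simp⟩
    · exact Ideal.mem_span_singleton.2 ⟨⟨0, 1⟩, rfl⟩
    · exact Ideal.mem_span_singleton.2 ⟨(2 * k + 1 : ℤ√m), by ext <;> simp [hm]; ring⟩
  · rw [Ideal.span_singleton_le_iff_mem]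
    have h1 : (⟨0, 1⟩ : ℤ√m) * ⟨0, 1⟩ ∈ Ideal.span {(2 : ℤ√m), ⟨0, 1⟩} * Ideal.span {(2 : ℤ√m), ⟨0, 1⟩} :=
      Ideal.mul_mem_mul (Ideal.subset_span (by simp)) (Ideal.subset_span (by simp))
    have h3 : (2 : ℤ√m) * 2 ∈ Ideal.span {(2 : ℤ√m), ⟨0, 1⟩} * Ideal.span {(2 : ℤ√m), ⟨0, 1⟩} :=
      Ideal.mul_mem_mul (Ideal.subset_span (by simp)) (Ideal.subset_span (by simp))
    have e : (2 : ℤ√m) = ((k : ℤ√m) + 1) * ((2 : ℤ√m) * 2) - (⟨0, 1⟩ : ℤ√m) * ⟨0, 1⟩ := by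
      ext <;> simp [hm]; ring
    have hmem := Ideal.sub_mem _ (Ideal.mul_mem_left _ ((k : ℤ√m) + 1) h3) h1
    rwa [← e] at hmem

/-- **`m = 4k + 1` (non-maximal order `ℤ[√m]`): `(2, 1 + √m)² = (2)·(2, 1 + √m) = 2𝔭`** — so `𝔭² ≠ (2)` there and `𝔭` is not invertible;
the `ℤ[√m]`-shadow of THEOREM R1-ℤ («m ≡ 1 (mod 4): never»). (`(1+l)² = (4k+2) + 2l = 2·((2k+1) + l) = 2·(2k + (1+l))`.) [kernel] -/
theorem pTwo_sq_one_mod_four {m : ℤ} (k : ℤ) (hm : m = 4 * k + 1) :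
    Ideal.span {(2 : ℤ√m), ⟨1, 1⟩} ^ 2 = Ideal.span {(2 : ℤ√m)} * Ideal.span {(2 : ℤ√m), ⟨1, 1⟩} := by
  rw [pow_two]
  apply le_antisymm
  · apply mul_mem_of_gens
    · exact Ideal.mul_mem_mul (Ideal.subset_span (by simp)) (Ideal.subset_span (by simp))
    · exact Ideal.mul_mem_mul (Ideal.subset_span (by simp)) (Ideal.subset_span (by simp))
    · have e : (⟨1, 1⟩ : ℤ√m) * ⟨1, 1⟩ = (2 : ℤ√m) * ((k : ℤ√m) * 2 + ⟨1, 1⟩) := by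
        ext <;> simp [hm]; ring
      rw [e]
      refine Ideal.mul_mem_mul (Ideal.subset_span (by simp)) ?_
      exact Ideal.add_mem _ (Ideal.mul_mem_left _ _ (Ideal.subset_span (by simp))) (Ideal.subset_span (by simp))
  · exact Ideal.mul_mono_left (Ideal.span_mono (by simp))

/-! ## §2 The twist and the conjugation -/

/-- **`A` odd ⟹ `(2, A + √m) = (2, 1 + √m)`** (`A + l = (1 + l) + 2·((A−1)∕2)`). [kernel] -/
theorem pTwo_twist_odd {m A : ℤ} (a : ℤ) (hA : A = 2 * a + 1) :
    Ideal.span {(2 : ℤ√m), ⟨A, 1⟩} = Ideal.span {(2 : ℤ√m), ⟨1, 1⟩} := by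
  have e1 : (⟨A, 1⟩ : ℤ√m) = (a : ℤ√m) * 2 + ⟨1, 1⟩ := by ext <;> simp [hA]; ring
  have e2 : (⟨1, 1⟩ : ℤ√m) = (-a : ℤ√m) * 2 + ⟨A, 1⟩ := by ext <;> simp [hA]; ring
  apply le_antisymm
  · rw [Ideal.span_le]
    intro t ht
    simp only [Set.mem_insert_iff, Set.mem_singleton_iff] at ht
    rcases ht with rfl | rfl
    · exact Ideal.subset_span (by simp)
    · rw [SetLike.mem_coe, e1]
      exact Ideal.add_mem _ (Ideal.mul_mem_left _ _ (Ideal.subset_span (by simp))) (Ideal.subset_span (by simp))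
  · rw [Ideal.span_le]
    intro t ht
    simp only [Set.mem_insert_iff, Set.mem_singleton_iff] at ht
    rcases ht with rfl | rfl
    · exact Ideal.subset_span (by simp)
    · rw [SetLike.mem_coe, e2]
      exact Ideal.add_mem _ (Ideal.mul_mem_left _ _ (Ideal.subset_span (by simp))) (Ideal.subset_span (by simp))

/-- **`A` even ⟹ `(2, A + √m) = (2, √m)`**. [kernel] -/
theorem pTwo_twist_even {m A : ℤ} (a : ℤ) (hA : A = 2 * a) :
    Ideal.span {(2 : ℤ√m), ⟨A, 1⟩} = Ideal.span {(2 : ℤ√m), ⟨0, 1⟩} := by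
  have e1 : (⟨A, 1⟩ : ℤ√m) = (a : ℤ√m) * 2 + ⟨0, 1⟩ := by ext <;> simp [hA]; ring
  have e2 : (⟨0, 1⟩ : ℤ√m) = (-a : ℤ√m) * 2 + ⟨A, 1⟩ := by ext <;> simp [hA]; ring
  apply le_antisymm
  · rw [Ideal.span_le]
    intro t ht
    simp only [Set.mem_insert_iff, Set.mem_singleton_iff] at ht
    rcases ht with rfl | rfl
    · exact Ideal.subset_span (by simp)
    · rw [SetLike.mem_coe, e1]
      exact Ideal.add_mem _ (Ideal.mul_mem_left _ _ (Ideal.subset_span (by simp))) (Ideal.subset_span (by simp))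
  · rw [Ideal.span_le]
    intro t ht
    simp only [Set.mem_insert_iff, Set.mem_singleton_iff] at ht
    rcases ht with rfl | rfl
    · exact Ideal.subset_span (by simp)
    · rw [SetLike.mem_coe, e2]
      exact Ideal.add_mem _ (Ideal.mul_mem_left _ _ (Ideal.subset_span (by simp))) (Ideal.subset_span (by simp))

/-- **`τ(𝔭) = 𝔭`**: `(2, 1 − √m) = (2, 1 + √m)` (`1 − l = 2 − (1 + l)`). [kernel] -/
theorem pTwo_conj {m : ℤ} : Ideal.span {(2 : ℤ√m), ⟨1, -1⟩} = Ideal.span {(2 : ℤ√m), ⟨1, 1⟩} := by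
  have e1 : (⟨1, -1⟩ : ℤ√m) = 2 - ⟨1, 1⟩ := by ext <;> simp
  have e2 : (⟨1, 1⟩ : ℤ√m) = 2 - ⟨1, -1⟩ := by ext <;> simp
  apply le_antisymm <;> rw [Ideal.span_le] <;> intro t ht <;>
    simp only [Set.mem_insert_iff, Set.mem_singleton_iff] at ht <;> rcases ht with rfl | rfl
  · exact Ideal.subset_span (by simp)
  · rw [SetLike.mem_coe, e1]; exact Ideal.sub_mem _ (Ideal.subset_span (by simp)) (Ideal.subset_span (by simp))
  · exact Ideal.subset_span (by simp)
  · rw [SetLike.mem_coe, e2]; exact Ideal.sub_mem _ (Ideal.subset_span (by simp)) (Ideal.subset_span (by simp))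

/-- `m` even: `τ(2, √m) = (2, −√m) = (2, √m)`. [kernel] -/
theorem pTwo_conj_even {m : ℤ} : Ideal.span {(2 : ℤ√m), ⟨0, -1⟩} = Ideal.span {(2 : ℤ√m), ⟨0, 1⟩} := by
  have e1 : (⟨0, -1⟩ : ℤ√m) = -⟨0, 1⟩ := by ext <;> simp
  have e2 : (⟨0, 1⟩ : ℤ√m) = -⟨0, -1⟩ := by ext <;> simp
  apply le_antisymm <;> rw [Ideal.span_le] <;> intro t ht <;>
    simp only [Set.mem_insert_iff, Set.mem_singleton_iff] at ht <;> rcases ht with rfl | rfl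
  · exact Ideal.subset_span (by simp)
  · rw [SetLike.mem_coe, e1]; exact (Ideal.neg_mem_iff _).2 (Ideal.subset_span (by simp))
  · exact Ideal.subset_span (by simp)
  · rw [SetLike.mem_coe, e2]; exact (Ideal.neg_mem_iff _).2 (Ideal.subset_span (by simp))

/-! ## §3 Principal generators from `x² − m·y² = ±2` -/

/-- **`m` odd, `x = 2a+1`, `y = 2b+1` odd, `x² − m·y² = 2ε` with `ε = ±1` ⟹ `(2, 1 + √m) = (x + y√m)`.**
(`⊆`: `2 = ε·z·z̄`, `1 + l = z·ε·((x − ym)∕2·… )` — precisely `(1+l)·z̄ = (x − ym) + (x − y)l` has even coordinates; `⊇`: `z = (x−y) + y(1+l)`.)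
[kernel] -/
theorem pTwo_principal_odd {m x y ε : ℤ} (a b : ℤ) (hx : x = 2 * a + 1) (hy : y = 2 * b + 1) (hε : ε = 1 ∨ ε = -1)
    (h : x ^ 2 - m * y ^ 2 = 2 * ε) :
    Ideal.span {(2 : ℤ√m), ⟨1, 1⟩} = Ideal.span {(⟨x, y⟩ : ℤ√m)} := by
  have hε2 : ε * ε = 1 := by rcases hε with rfl | rfl <;> norm_num
  -- m is odd (x, y odd and x² − m y² even)
  have hm1 : m % 2 = 1 := by
    rcases Int.emod_two_eq_zero_or_one m with hm0 | hm1
    · exfalso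
      obtain ⟨c, hc⟩ : (2 : ℤ) ∣ m := Int.dvd_of_emod_eq_zero hm0
      have : (2 : ℤ) ∣ 1 := ⟨ε - 2 * a ^ 2 - 2 * a + c * y ^ 2, by rw [hx, hc] at h; linarith⟩
      omega
    · exact hm1
  obtain ⟨c, hc⟩ : ∃ c : ℤ, m = 2 * c + 1 := ⟨m / 2, by omega⟩
  -- the quotient w̃ = (1 + l)·z̄ ∕ 2 = (a − 2bc − b − c) + (a − b)·l satisfies z·w̃ = ε·(1 + l)
  have h' := h
  rw [hx, hy, hc] at h'
  have hP : x * (a - 2 * b * c - b - c) + m * y * (a - b) = ε := by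
    rw [hx, hy, hc]; linarith
  have hQ : x * (a - b) + y * (a - 2 * b * c - b - c) = ε := by
    rw [hx, hy]; linarith
  apply le_antisymm
  · rw [Ideal.span_le]
    intro t ht
    simp only [Set.mem_insert_iff, Set.mem_singleton_iff] at ht
    rcases ht with rfl | rfl
    · -- 2 = z · (ε z̄)
      rw [SetLike.mem_coe, Ideal.mem_span_singleton]
      refine ⟨(ε : ℤ√m) * ⟨x, -y⟩, ?_⟩
      ext
      · simp; linear_combination (-ε) * h - 2 * hε2
      · simp; ring
    · -- 1 + l = z · (ε w̃)
      rw [SetLike.mem_coe, Ideal.mem_span_singleton]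
      refine ⟨(ε : ℤ√m) * ⟨a - 2 * b * c - b - c, a - b⟩, ?_⟩
      ext
      · simp; linear_combination (-ε) * hP - hε2
      · simp; linear_combination (-ε) * hQ - hε2
  · rw [Ideal.span_singleton_le_iff_mem]
    have e : (⟨x, y⟩ : ℤ√m) = ((a : ℤ√m) - b) * 2 + (y : ℤ√m) * ⟨1, 1⟩ := by
      ext <;> simp [hx, hy]; ring
    rw [e]
    exact Ideal.add_mem _ (Ideal.mul_mem_left _ _ (Ideal.subset_span (by simp)))
      (Ideal.mul_mem_left _ _ (Ideal.subset_span (by simp)))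

/-- **`m` even `= 2c`, `x = 2a` even, `y` odd, `x² − m·y² = 2ε`, `ε = ±1` ⟹ `(2, √m) = (x + y√m)`.**
(`2 = ε z z̄`; `l·z̄ = −ym + x l = 2·(−yc + a l)`, so `l = z·ε(−yc + a l)`; `z = a·2 + y·l`.) [kernel] -/
theorem pTwo_principal_even {m x y ε : ℤ} (a c : ℤ) (hm : m = 2 * c) (hx : x = 2 * a)
    (hε : ε = 1 ∨ ε = -1) (h : x ^ 2 - m * y ^ 2 = 2 * ε) :
    Ideal.span {(2 : ℤ√m), ⟨0, 1⟩} = Ideal.span {(⟨x, y⟩ : ℤ√m)} := by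
  have hε2 : ε * ε = 1 := by rcases hε with rfl | rfl <;> norm_num
  have h' := h
  rw [hm, hx] at h'
  have hP : x * (-(y * c)) + m * y * a = 0 := by rw [hm, hx]; ring
  have hQ : x * a + y * (-(y * c)) = ε := by rw [hx]; linarith
  apply le_antisymm
  · rw [Ideal.span_le]
    intro t ht
    simp only [Set.mem_insert_iff, Set.mem_singleton_iff] at ht
    rcases ht with rfl | rfl
    · rw [SetLike.mem_coe, Ideal.mem_span_singleton]
      refine ⟨(ε : ℤ√m) * ⟨x, -y⟩, ?_⟩
      ext
      · simp; linear_combination (-ε) * h - 2 * hε2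
      · simp; ring
    · rw [SetLike.mem_coe, Ideal.mem_span_singleton]
      refine ⟨(ε : ℤ√m) * ⟨-(y * c), a⟩, ?_⟩
      ext
      · simp; linear_combination (-ε) * hP
      · simp; linear_combination (-ε) * hQ - hε2
  · rw [Ideal.span_singleton_le_iff_mem]
    have e : (⟨x, y⟩ : ℤ√m) = (a : ℤ√m) * 2 + (y : ℤ√m) * ⟨0, 1⟩ := by
      ext <;> simp [hx]; ring
    rw [e]
    exact Ideal.add_mem _ (Ideal.mul_mem_left _ _ (Ideal.subset_span (by simp)))
      (Ideal.mul_mem_left _ _ (Ideal.subset_span (by simp)))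

/-- **Instances.** `ℚ(√7)`: `(2, 1+√7) = (3+√7)` (norm `+2`); `ℚ(√31)`: `(2, 1+√31) = (39+7√31)` (norm `+2`, the first `y > 1` witness);
`ℚ(√3)`: `(2, 1+√3) = (1+√3)` (norm `−2`: `𝔭` principal although R1 PROPER is never reached for `ℚ(√3)`); `ℚ(i)`: `(2, 1+i) = (1+i)`;
`ℚ(√−2)`: `(2, √−2) = (√−2)`. [kernel] -/
theorem instances :
    Ideal.span {(2 : ℤ√7), ⟨1, 1⟩} = Ideal.span {(⟨3, 1⟩ : ℤ√7)} ∧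
    Ideal.span {(2 : ℤ√31), ⟨1, 1⟩} = Ideal.span {(⟨39, 7⟩ : ℤ√31)} ∧
    Ideal.span {(2 : ℤ√3), ⟨1, 1⟩} = Ideal.span {(⟨1, 1⟩ : ℤ√3)} ∧
    Ideal.span {(2 : ℤ√(-1)), ⟨1, 1⟩} = Ideal.span {(⟨1, 1⟩ : ℤ√(-1))} ∧
    Ideal.span {(2 : ℤ√(-2)), ⟨0, 1⟩} = Ideal.span {(⟨0, 1⟩ : ℤ√(-2))} := by
  refine ⟨?_, ?_, ?_, ?_, ?_⟩
  · exact pTwo_principal_odd (ε := 1) 1 0 (by norm_num) (by norm_num) (Or.inl rfl) (by norm_num)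
  · exact pTwo_principal_odd (ε := 1) 19 3 (by norm_num) (by norm_num) (Or.inl rfl) (by norm_num)
  · exact pTwo_principal_odd (ε := -1) 0 0 (by norm_num) (by norm_num) (Or.inr rfl) (by norm_num)
  · exact pTwo_principal_odd (ε := 1) 0 0 (by norm_num) (by norm_num) (Or.inl rfl) (by norm_num)
  · exact pTwo_principal_even (ε := 1) 0 (-1) (by norm_num) (by norm_num) (Or.inl rfl) (by norm_num)

end Summit.Ventures.HSemireg.PrimeOverTwo
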